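import Summits.Ventures.QEC.Thresholds.DepolarizingThresholds
import Summits.Ventures.QEC.Thresholds.PlanarSurfaceCodeThresholds
import Summits.Ventures.QEC.Census.HGP.Core2
import Mathlib.LinearAlgebra.FiniteDimensional.Basic
import HarnessLib

/-!
# The planar surface codes as the census object `HGP.code (rep, rep)`: one logical qubit (Tillich–Zémor Thm 7),
# census bridge to row `HGP_rep6_x_rep6 = [[61,1,6]]`, and the certified DEPOLARIZING threshold `(3/2)·p₀(3)`

Venture QEC, `Summits/Ventures/QEC/Thresholds/` (LADDER-QEC rung Q5, PARTITION row 09 "noise models: i.i.d.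
depolarising"; qec-type-09 gen 3). qec-lit-2's `PlanarSurfaceCodeThresholds.lean` certifies BOTH sectors of the
planar surface code family `planarHX k` / `planarHZ k` (`HGP(H, Hᵀ)`, `H` the `(k+1) × (k+2)` repetition
parity-check matrix) under independent flips (`p₀(3)`), erasures (`1/3`) and phenomenological noise (`p₀(5)`). This
file (i) identifies that family with the CENSUS object `planarHGPCode k := HGP.code (repMatrix (k+1)) (repMatrix (k+1))`
(row type-04's `Summit.Ventures.QEC.HGP.code`; `(planarHGPCode k).HX = planarHX k` and `.HZ = planarHZ k` by `rfl`, and the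
two failure families of `CSSFamilyThresholds.lean` ARE lit-2's `planarFailureFamily` / `planarFailureFamily'`, by
`rfl`), (ii) proves `k = 1` logical qubit for every size (`planarHGPCode_k`, TZ Thm 7 via `rank_repMatrix`; lit-2's
`planarXString_logical` exhibits the logical, this counts them), (iii) the census bridge `repMatrix 5 = rowMatrix 6
[3, 6, 12, 24, 48]` (`decide`) so `(planarHGPCode 4).IsCode 61 1 6` is census row `HGP_rep6_x_rep6`, and (iv) the
DEPOLARIZING threshold `planar_depolarizing_isThresholdLowerBound : IsThresholdLowerBound (depolarizingFailureFamily
(fun k => planarHGPCode k) DX DZ) (3/2 · thresholdValue 3)` for every pair of minimum-weight decoder families (the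
`3/2` rule of `DepolarizingThresholds.lean` on lit-2's two sector theorems), decimal `p_c^depol > .0427`, canonical
instance. UNCONDITIONAL, kernel axioms, no named fact, no `native_decide`.

HONEST FRAMING: sector-wise (correlation-blind) minimum-weight decoding; `3/2` is the exact marginal rate
conversion; the optimal-decoder depolarizing threshold of the surface code (`≈ .189`, numerics) is not claimed.

## References

* [TillichZemor2014] J.-P. Tillich, G. Zémor, IEEE Trans. IT 60 (2014) 1193, §3 (planar code = product of a
  repetition code with its transpose), Thm 7.
* [DumerKovalevPryadko2015] I. Dumer, A. A. Kovalev, L. P. Pryadko, PRL 115 (2015) 050502, Thm 2, eq.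
  (succesful-decoding-depolarizing).
* [DennisEtAl2002] E. Dennis, A. Kitaev, A. Landahl, J. Preskill, J. Math. Phys. 43 (2002) 4452, §4.1.
-/

noncomputable section

namespace Summit.Ventures.QEC.Thresholds

open Finset Matrix Module
open Literature.InformationTheory.QuantumCodes
open Literature.InformationTheory.Coding (minDist)

/-! ### The planar surface code as a census hypergraph product -/

/-- **The `k`-th planar surface code as the census object** `HGP.code (repMatrix (k+1)) (repMatrix (k+1))`
(`(k+2)² + (k+1)²` qubits; `H^X = planarHX k`, `H^Z = planarHZ k`). Definition (reducible).
[cite: TillichZemor2014, §3 (the planar code as the product of a repetition code with its transpose)] -/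
abbrev planarHGPCode (k : ℕ) : CSSCode (PlanarCheck k) (PlanarZCheck k) (PlanarQubit k) :=
  HGP.code (repMatrix (k + 1)) (repMatrix (k + 1))

/-- Its `X`-check matrix is lit-2's `planarHX k` (definitional). [cite: TillichZemor2014, §3-§4 (H_X of the product)] -/
theorem planarHGPCode_HX (k : ℕ) : (planarHGPCode k).HX = planarHX k := rfl

/-- Its `Z`-check matrix is lit-2's `planarHZ k` (definitional). [cite: TillichZemor2014, §3-§4 (H_Z of the product)] -/
theorem planarHGPCode_HZ (k : ℕ) : (planarHGPCode k).HZ = planarHZ k := rfl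

/-- The census `Z`-sector failure family of the planar codes IS lit-2's `planarFailureFamily` (definitional).
[cite: DumerKovalevPryadko2015, eq. (succesful-decoding)] -/
theorem zFailureFamily_planarHGPCode (D : ∀ k, Decoder (PlanarCheck k → ZMod 2) (PlanarQubit k → ZMod 2)) :
    zFailureFamily (fun k => planarHGPCode k) D = planarFailureFamily D := rfl

/-- The census `X`-sector failure family of the planar codes IS lit-2's `planarFailureFamily'` (definitional).
[cite: DumerKovalevPryadko2015, eq. (succesful-decoding)] -/
theorem xFailureFamily_planarHGPCode (D : ∀ k, Decoder (PlanarZCheck k → ZMod 2) (PlanarQubit k → ZMod 2)) :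
    xFailureFamily (fun k => planarHGPCode k) D = planarFailureFamily' D := rfl

/-- **The repetition parity-check matrix has full row rank `n`** (`ker Hᵀ = 0`). [cite: TillichZemor2014, §3 (repetition code; dᵀ = ∞)] -/
theorem rank_repMatrix (n : ℕ) : (repMatrix n).rank = n := by
  have h := rank_add_finrank_pcCode (repMatrix n)ᵀ
  rw [pcCode_repMatrix_transpose_eq_bot, finrank_bot, Matrix.rank_transpose, Fintype.card_fin, add_zero] at h
  exact h

/-- **One logical qubit for every size** (Tillich–Zémor Thm 7: `(k+2-(k+1))² + (k+1-(k+1))² = 1`) — non-vacuity of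
both sectors. [cite: TillichZemor2014, Thm 7] -/
theorem planarHGPCode_k (k : ℕ) : (planarHGPCode k).k = 1 := by
  rw [planarHGPCode, HGP.code_k_eq _ _ (rank_repMatrix (k + 1)) (rank_repMatrix (k + 1))]
  have h1 : k + 2 - (k + 1) = 1 := by omega
  rw [h1, Nat.sub_self]

/-- A `Z`-logical exists (`d^Z > 0`). [cite: BravyiEtAl2024, §4 Lemma 1 (k > 0 ⇒ logical operators)] -/
theorem planarHGPCode_dZ_pos (k : ℕ) : 0 < (planarHGPCode k).dZ :=
  (planarHGPCode k).dZ_pos_of_k_pos (by rw [planarHGPCode_k]; norm_num)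

/-- An `X`-logical exists (`d^X > 0`). [cite: BravyiEtAl2024, §4 Lemma 1 (k > 0 ⇒ logical operators)] -/
theorem planarHGPCode_dX_pos (k : ℕ) : 0 < (planarHGPCode k).dX :=
  (planarHGPCode k).dX_pos_of_k_pos (by rw [planarHGPCode_k]; norm_num)

/-- `d^Z ≥ k+2` (lit-2's `le_hammingNorm_of_planar_cycle`, TZ Thm 9). [cite: TillichZemor2014, Thm 9] -/
theorem planarHGPCode_le_dZ (k : ℕ) : k + 2 ≤ (planarHGPCode k).dZ :=
  (planarHGPCode k).le_dZ ((planarHGPCode k).dZ_pos_iff.1 (planarHGPCode_dZ_pos k)) fun x hx hxS =>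
    le_hammingNorm_of_planar_cycle k x hx hxS

/-- `d^X ≥ k+2` (lit-2's `le_hammingNorm_of_planar_cocycle`, TZ Thm 9 cocycle half). [cite: TillichZemor2014, Thm 9] -/
theorem planarHGPCode_le_dX (k : ℕ) : k + 2 ≤ (planarHGPCode k).dX :=
  (planarHGPCode k).le_dX ((planarHGPCode k).dX_pos_iff.1 (planarHGPCode_dX_pos k)) fun x hx hxS =>
    le_hammingNorm_of_planar_cocycle k x hx hxS

/-- **Census bridge**: the `k = 4` repetition matrix IS the registered census seed `rep6` (`rowMatrix 6 [3, 6, 12, 24, 48]`),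
entrywise by `decide`. [cite: TillichZemor2014, §3 (repetition code)] -/
theorem repMatrix_five_eq : repMatrix 5 = Census.rowMatrix 6 [3, 6, 12, 24, 48] := by
  decide

/-- The `k = 4` planar code of this family is census row `HGP_rep6_x_rep6 = [[61, 1, 6]]` (type-04's kernel theorem
`Census.HGP.isCode_HGP_rep6_x_rep6`, exact distance). [cite: TillichZemor2014, Thm 7, Thm 9 ([[n² + (n-1)², 1, n]] at n = 6)] -/
theorem planarHGPCode_four_isCode : (planarHGPCode 4).IsCode 61 1 6 := by
  rw [planarHGPCode, repMatrix_five_eq]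
  exact Census.HGP.isCode_HGP_rep6_x_rep6

/-! ### The depolarizing threshold -/

/-- **Depolarizing threshold `≥ (3/2)·p₀(3) = (3-2√2)/4 ≈ .0429` for the planar surface codes**, decoded sector-wise
by ANY pair of minimum-weight decoder families (`DX` of the `Z`-syndrome on bit flips, `DZ` of the `X`-syndrome on
phase flips). UNCONDITIONAL (lit-2's two sector thresholds `p₀(3)` + the `3/2` rule).
[cite: DennisEtAl2002, §4.1 (depolarizing channel; X and Z errors corrected separately)] [cite: DumerKovalevPryadko2015, Thm 2 (w = 4)] -/
theorem planar_depolarizing_isThresholdLowerBound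
    (DX : ∀ k, Decoder (PlanarZCheck k → ZMod 2) (PlanarQubit k → ZMod 2))
    (DZ : ∀ k, Decoder (PlanarCheck k → ZMod 2) (PlanarQubit k → ZMod 2))
    (hDX : ∀ k, (DX k).IsMinWeight (fun e => planarHZ k *ᵥ e) {x | planarHZ k *ᵥ x = 0} hammingNorm)
    (hDZ : ∀ k, (DZ k).IsMinWeight (fun e => planarHX k *ᵥ e) {x | planarHX k *ᵥ x = 0} hammingNorm) :
    IsThresholdLowerBound (depolarizingFailureFamily (fun k => planarHGPCode k) DX DZ)
      (3 / 2 * thresholdValue 3) := by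
  have hX : IsThresholdLowerBound (xFailureFamily (fun k => planarHGPCode k) DX) (thresholdValue 3) := by
    rw [xFailureFamily_planarHGPCode]
    exact planar_isThresholdLowerBound' DX hDX
  have hZ : IsThresholdLowerBound (zFailureFamily (fun k => planarHGPCode k) DZ) (thresholdValue 3) := by
    rw [zFailureFamily_planarHGPCode]
    exact planar_isThresholdLowerBound DZ hDZ
  have h := depolarizing_isThresholdLowerBound (fun k => planarHGPCode k) DX DZ hX hZ
    ((min_le_left _ _).trans (thresholdValue_le_two_thirds _))
  rwa [min_self] at h

/-- Canonical instance: minimum-weight decoding of both syndromes of the planar surface codes has depolarizing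
threshold `≥ (3/2)·p₀(3)`. [cite: DennisEtAl2002, §4.1] -/
theorem planar_depolarizing_isThresholdLowerBound_minWeight :
    IsThresholdLowerBound
      (depolarizingFailureFamily (fun k => planarHGPCode k)
        (fun k => Decoder.minWeight (fun e : PlanarQubit k → ZMod 2 => planarHZ k *ᵥ e) hammingNorm)
        fun k => Decoder.minWeight (fun e : PlanarQubit k → ZMod 2 => planarHX k *ᵥ e) hammingNorm)
      (3 / 2 * thresholdValue 3) :=
  planar_depolarizing_isThresholdLowerBound _ _
    (fun k => (planarHGPCode k).isMinWeight_minWeight_xSyndrome) fun k => planar_isMinWeight_minWeight k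

/-- **`p_c^depol > .0427`** (decimal, kernel) for the planar surface codes under sector-wise minimum-weight decoding.
[cite: DennisEtAl2002, §4.1 and §5.3] -/
theorem planar_depolarizing_accuracyThreshold_gt
    (DX : ∀ k, Decoder (PlanarZCheck k → ZMod 2) (PlanarQubit k → ZMod 2))
    (DZ : ∀ k, Decoder (PlanarCheck k → ZMod 2) (PlanarQubit k → ZMod 2))
    (hDX : ∀ k, (DX k).IsMinWeight (fun e => planarHZ k *ᵥ e) {x | planarHZ k *ᵥ x = 0} hammingNorm)
    (hDZ : ∀ k, (DZ k).IsMinWeight (fun e => planarHX k *ᵥ e) {x | planarHX k *ᵥ x = 0} hammingNorm) :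
    (0.0427 : ℝ) < accuracyThreshold (depolarizingFailureFamily (fun k => planarHGPCode k) DX DZ) := by
  have h3 := thresholdValue_three_bounds.1
  refine lt_of_lt_of_le (by linarith)
    (le_accuracyThreshold (planar_depolarizing_isThresholdLowerBound DX DZ hDX hDZ) ?_)
  have := thresholdValue_le_half (3 : ℝ)
  linarith

end Summit.Ventures.QEC.Thresholds
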